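import Literature.RepresentationTheory.FiniteGroups.GL2ModularPrincipalSeriesReduction
import Mathlib.RingTheory.Localization.Integer
import HarnessLib

/-!
# Change of coefficients `Fun_R(Ind(χ₁ ⊗ χ₂)) → Fun_K(Ind(χ₁ ⊗ χ₂))` along an injective / localising algebra

Topic `Literature/RepresentationTheory/FiniteGroups`, namespace `Literature.RepresentationTheory.FiniteGroups.GL2`.
THEOREMS ONLY; no named fact, no instance, no notation, no `sorry`.

The same map `reduce K χ₁ χ₂` (pointwise `algebraMap R K`, tree `GL2ModularPrincipalSeriesReduction`) that reduces the
standard lattice modulo `ϖ` also COMPARES it with the principal series over an extension of scalars, e.g. the fraction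
field `K = Frac R` (`ℤ_p ⊂ ℚ_p`) [SerreLinearRepresentations1977, §15.1: "a lattice of the `K`-space `V` … generates
`V` over `K`"; EmertonGeeSavitt2015, §4.1 (`𝒪`-lattices in `E`-representations)]:

* `reduce_injective_of_injective` — if `R → K` is injective, `Fun_R(Ind) → Fun_K(Ind)` is injective;
* `bruhatLift_single_eq_reduce` — the Bruhat basis vectors of `Fun_K` are images of those of `Fun_R`;
* **`span_range_reduce_eq_top`** — the image `K`-spans `Fun_K(Ind(χ₁ ⊗ χ₂))` (any algebra `R → K`);
* **`exists_smul_mem_range_reduce`** — over a localisation `K = R[M⁻¹]` every element of `Fun_K(Ind)` has a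
  multiple `b • w`, `b ∈ M`, in the image (clearing the `#F + 1` Bruhat denominators).

So `Fun_R(Ind(χ₁ ⊗ χ₂))` is an `R`-LATTICE in `Fun_{Frac R}(Ind(χ₁ ⊗ χ₂))`; this is the entry point for a consumer
holding a rational isomorphism `Λ ⊗ ℚ_p ≅ Ind_{ℚ_p}(χ₁ ⊗ χ₂)` (the tame type of a modular Galois representation) who
wants to place `Λ` as a finite-index stable sublattice of the standard lattice (`GL2ModularPrincipalSeriesLatticeUnique*`).
-/

noncomputable section

namespace Literature.RepresentationTheory.FiniteGroups

namespace GL2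

open Function

section BaseChange

variable {F : Type} [Field F] [DecidableEq F] {R : Type} [CommRing R] {K : Type} [CommRing K] [Algebra R K]
  (χ₁ χ₂ : Fˣ →* Rˣ)

omit [DecidableEq F] in
/-- **`Fun_R(Ind) → Fun_K(Ind)` is injective when `R → K` is** (e.g. `ℤ_p ⊂ ℚ_p`).
[cite: SerreLinearRepresentations1977, §15.1] -/
theorem reduce_injective_of_injective (hinj : Injective (algebraMap R K)) :
    Injective (reduce K χ₁ χ₂) := by
  intro f g hfg
  refine Subtype.ext (funext fun x => hinj ?_)
  have := congrArg (fun u => ((u : Representation.coindV (borel F).subtype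
    (scalarRep (borelCharacter F (reduceChar K χ₁) (reduceChar K χ₂)))) : GL (Fin 2) F → K) x) hfg
  simpa using this

/-- The Bruhat basis vector of `Fun_K` at `o` is the image of the Bruhat basis vector of `Fun_R` at `o`.
[cite: SerreLinearRepresentations1977, §15.1] -/
theorem bruhatLift_single_eq_reduce (o : Option F) :
    bruhatLift (reduceChar K χ₁) (reduceChar K χ₂) (Pi.single o 1) =
      reduce K χ₁ χ₂ (bruhatLift χ₁ χ₂ (Pi.single o 1)) := by
  apply (bruhatEquiv (reduceChar K χ₁) (reduceChar K χ₂)).injective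
  funext o'
  rw [bruhatEquiv_apply, bruhatEquiv_apply, bruhatEval_bruhatLift, bruhatEval_reduce, bruhatEval_bruhatLift]
  by_cases h : o' = o
  · subst h; rw [Pi.single_eq_same, Pi.single_eq_same, map_one]
  · rw [Pi.single_eq_of_ne h, Pi.single_eq_of_ne h, map_zero]

/-- **The image of `Fun_R(Ind(χ₁ ⊗ χ₂))` spans `Fun_K(Ind(χ̄₁ ⊗ χ̄₂))` over `K`** (for any algebra `R → K`: it
contains the Bruhat basis). [cite: SerreLinearRepresentations1977, §15.1] -/
theorem span_range_reduce_eq_top [Fintype F] :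
    Submodule.span K (Set.range (reduce K χ₁ χ₂)) = ⊤ := by
  classical
  rw [eq_top_iff]
  intro w _
  -- expand `w` in the Bruhat basis
  have hw : w = ∑ o : Option F, bruhatEval (reduceChar K χ₁) (reduceChar K χ₂) w o •
      bruhatLift (reduceChar K χ₁) (reduceChar K χ₂) (Pi.single o 1) := by
    apply (bruhatEquiv (reduceChar K χ₁) (reduceChar K χ₂)).injective
    rw [map_sum]
    funext o'
    rw [bruhatEquiv_apply, Finset.sum_apply]
    simp only [map_smul, bruhatEquiv_apply, bruhatEval_bruhatLift, Pi.smul_apply, smul_eq_mul,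
      Pi.single_apply, mul_ite, mul_one, mul_zero, Finset.sum_ite_eq, Finset.mem_univ, if_true]
  rw [hw]
  refine Submodule.sum_mem _ fun o _ => Submodule.smul_mem _ _ ?_
  rw [bruhatLift_single_eq_reduce]
  exact Submodule.subset_span ⟨_, rfl⟩

/-- **Clearing denominators**: over a localisation `K = R[M⁻¹]` (e.g. `K = Frac R`), every `w ∈ Fun_K(Ind)` has a
multiple `b • w` (`b ∈ M`) in the image of `Fun_R(Ind)` — i.e. `Fun_R(Ind(χ₁ ⊗ χ₂))` is an `R`-lattice of
`Fun_K(Ind(χ₁ ⊗ χ₂))`. [cite: SerreLinearRepresentations1977, §15.1] -/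
theorem exists_smul_mem_range_reduce [Fintype F] (M : Submonoid R) [IsLocalization M K]
    (w : Representation.coindV (borel F).subtype
      (scalarRep (borelCharacter F (reduceChar K χ₁) (reduceChar K χ₂)))) :
    ∃ b : M, (b : R) • w ∈ LinearMap.range (reduce K χ₁ χ₂).toLinearMap := by
  obtain ⟨b, hb⟩ := IsLocalization.exist_integer_multiples_of_finite M
    (bruhatEval (reduceChar K χ₁) (reduceChar K χ₂) w)
  choose c hc using hb
  refine ⟨b, bruhatLift χ₁ χ₂ c, ?_⟩
  apply (bruhatEquiv (reduceChar K χ₁) (reduceChar K χ₂)).injective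
  funext o
  rw [bruhatEquiv_apply, bruhatEquiv_apply, Representation.IntertwiningMap.toLinearMap_apply, bruhatEval_reduce,
    bruhatEval_bruhatLift, LinearMap.map_smul_of_tower, Pi.smul_apply, hc]

end BaseChange

end GL2

end Literature.RepresentationTheory.FiniteGroups
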